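/-
Copyright (c) 2026. All rights reserved.
Released under Apache 2.0 license as described in the file LICENSE.
-/
import Literature.Probability.FitznerVanDerHofstad2017.NobleBoundsN1Classes
import HarnessLib

/-!
# Fitzner–van der Hofstad (2017), §6.1 — assembly of the `x`-space bound on `Ξ^{(1),ι}` from class estimates

[FvdH17] = R. Fitzner, R. van der Hofstad, *Mean-field behavior for nearest-neighbor percolation in `d > 10`*,
Electron. J. Probab. **22** (2017), no. 43, arXiv:1506.07977v2.

§6.1, proof of Lemma 5.3 (v2 pp. 59–60): "`Ξ^{(1),ι}_p(x) ≤ Σ_{a,b=0}^{2} Σ_{u,κ,w,z,t} (δ_{a,0} δ_{ι,κ} 𝟙{u=w=0}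
+ P^{ι,a}(u,w)) Ā^{κ,a,b}(u,w,t,z) P^{E,b}(t−x,z−x)`. … The right triangle `z,t,x` and the square `w,z,t,b̲` are
bounded in the same way as the left triangle and the middle piece of `Ξ^{(1)}_p`. … {\bf Case a=0.} … this is the
only contribution due to `F^{ι,III}_0`. If `F^{ι,III}_0` occurs, then we have `w=u=0` and `κ=ι`."

This module is the `ι`-twin of `NobleBoundsN1Classes` §B: it fixes the INTERFACE between the class estimates for
`Ξ^{(1),ι}` and the `x`-space bound above, written with the primed middle element `Ā' = blockAbar'`
(`NobleBlocksPrime`) and the Kronecker prefactor `kdeltaPref ι κ a u w = δ_{a,0} δ_{κ,ι} δ_{0,u} δ_{0,w}`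
(`NobleWeightedBlocks`), i.e. exactly the hypothesis `hΞ` (at `N = 1`) of
`NobleBlocks.tsum_ofReal_nobleXiIotaN_le_vecPiota_matAbarIota'_vecPE`:

* `le_tsum_kdeltaPref_blocks` — the trivial-start terms: `Σ_{t,z} Σ_b Ā'^{ι,0,b}(0,0,t,z) P^{E,b}(t−x,z−x)` is
  dominated by the `kdeltaPref` part of the bound;
* `measure_le_sum_inter_lineCls` — splitting an event by the class of ONE line;
* `nobleXiIotaT_one_le_blocks_of_cls` — **the assembly**: if `Ξ^{(1),ι}(x)` is bounded by a bond-summed two-level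
  part (the contributions of `F^{ι,I}_0 ∪ F^{ι,II}_0`) plus a bond-free part (the contribution of `F^{ι,III}_0`,
  `b₀ = (0,e_ι)`, `w₀ = 0`), and the CLASS ESTIMATES hold — classes `(a,b)` of the first part against
  `Σ_κ 𝟙{v = u+e_κ} P^{ι,a}(u,w) Ā'^{κ,a,b}(u,w,t,z) P^{E,b}(t−x,z−x)`, classes `b` of the second part against
  `Ā'^{ι,0,b}(0,0,t,z) P^{E,b}(t−x,z−x)` — then the displayed `x`-space bound holds.

Pure `[0,∞]` bookkeeping over abstract events `E`, `E₃`; the events and the class estimates are supplied by other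
modules.  No named fact, no numeral, no dimension is fixed; nothing here is a cited hypothesis.
-/

noncomputable section

namespace Literature.Probability.FitznerVanDerHofstad2017

open _root_.MeasureTheory Literature.Barriers.CriticalPhenomena Literature.Probability.Percolation
open Literature.Probability.LatticeModels _root_.SimpleGraph
open Literature.Probability.FitznerVanDerHofstad2017.NobleBlocks
open scoped ENNReal

variable {d : ℕ}

/-! ### A. Splitting by the class of one line -/

/-- **Splitting an event by the class of one line**: `μ(E) ≤ Σ_k μ(E ∩ {line (a,b) on level i has class k})`.
[cite: FitznerVanDerHofstad2017, §6.1 "we consider the different cases a = 0, 1, ≥ 2" (arXiv:1506.07977v2 p. 59)] -/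
theorem measure_le_sum_inter_lineCls (μ : Measure (Fin 2 → BondConfig (Site d)))
    (E : Set (Fin 2 → BondConfig (Site d))) (a b : Site d) (i : Fin 2) :
    μ E ≤ ∑ k : Fin 3, μ (E ∩ lineCls a b i k) := by
  have hcov : E ⊆ ⋃ k, E ∩ lineCls a b i k := by
    intro ω hω
    obtain ⟨k, hk⟩ := exists_mem_lineCls a b i ω
    exact Set.mem_iUnion.2 ⟨k, hω, hk⟩
  calc μ E ≤ μ (⋃ k, E ∩ lineCls a b i k) := measure_mono hcov
    _ ≤ ∑' k, μ (E ∩ lineCls a b i k) := measure_iUnion_le _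
    _ = ∑ k, μ (E ∩ lineCls a b i k) := by simp only [tsum_fintype]

/-! ### B. The trivial-start terms -/

/-- `kdeltaPref ι ι 0 0 0 = 1`. [folklore] -/
theorem kdeltaPref_self_zero (ι : Fin d × Bool) : kdeltaPref ι ι 0 (0 : Site d) 0 = 1 := by
  simp [kdeltaPref, kd]

/-- **The trivial-start terms are inside the `kdeltaPref` part**: for any kernel `C(κ,a,b,u,w,t,z)`,
`Σ_{t,z} Σ_b C(ι,0,b,0,0,t,z) ≤ Σ_{u,w,t,z} Σ_{κ,a,b} δ_{a,0} δ_{κ,ι} δ_{0,u} δ_{0,w} C(κ,a,b,u,w,t,z)`.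
[folklore] -/
theorem le_tsum_kdeltaPref_blocks (ι : Fin d × Bool)
    (C : Fin d × Bool → Fin 3 → Fin 3 → Site d → Site d → Site d → Site d → ℝ≥0∞) :
    ∑' t : Site d, ∑' z : Site d, ∑ b : Fin 3, C ι 0 b 0 0 t z ≤
      ∑' u : Site d, ∑' w : Site d, ∑' t : Site d, ∑' z : Site d, ∑ κ : Fin d × Bool, ∑ a : Fin 3, ∑ b : Fin 3,
        kdeltaPref ι κ a u w * C κ a b u w t z := by
  classical
  -- the terms `u = 0`, `w = 0`, `κ = ι`, `a = 0`
  have hin : ∀ t z : Site d, ∑ b : Fin 3, C ι 0 b 0 0 t z ≤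
      ∑ κ : Fin d × Bool, ∑ a : Fin 3, ∑ b : Fin 3, kdeltaPref ι κ a 0 0 * C κ a b 0 0 t z := by
    intro t z
    calc ∑ b : Fin 3, C ι 0 b 0 0 t z = ∑ b : Fin 3, kdeltaPref ι ι 0 (0 : Site d) 0 * C ι 0 b 0 0 t z := by
          simp only [kdeltaPref_self_zero, one_mul]
      _ ≤ ∑ a : Fin 3, ∑ b : Fin 3, kdeltaPref ι ι a (0 : Site d) 0 * C ι a b 0 0 t z :=
          Finset.single_le_sum (f := fun a => ∑ b : Fin 3, kdeltaPref ι ι a (0 : Site d) 0 * C ι a b 0 0 t z)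
            (fun _ _ => zero_le) (Finset.mem_univ 0)
      _ ≤ ∑ κ : Fin d × Bool, ∑ a : Fin 3, ∑ b : Fin 3, kdeltaPref ι κ a (0 : Site d) 0 * C κ a b 0 0 t z :=
          Finset.single_le_sum
            (f := fun κ => ∑ a : Fin 3, ∑ b : Fin 3, kdeltaPref ι κ a (0 : Site d) 0 * C κ a b 0 0 t z)
            (fun _ _ => zero_le) (Finset.mem_univ ι)
  calc ∑' t : Site d, ∑' z : Site d, ∑ b : Fin 3, C ι 0 b 0 0 t z
      ≤ ∑' t : Site d, ∑' z : Site d, ∑ κ : Fin d × Bool, ∑ a : Fin 3, ∑ b : Fin 3,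
          kdeltaPref ι κ a 0 0 * C κ a b 0 0 t z :=
        ENNReal.tsum_le_tsum fun t => ENNReal.tsum_le_tsum fun z => hin t z
    _ ≤ ∑' w : Site d, ∑' t : Site d, ∑' z : Site d, ∑ κ : Fin d × Bool, ∑ a : Fin 3, ∑ b : Fin 3,
          kdeltaPref ι κ a 0 w * C κ a b 0 w t z :=
        ENNReal.le_tsum (f := fun w : Site d => ∑' t : Site d, ∑' z : Site d, ∑ κ : Fin d × Bool, ∑ a : Fin 3,
          ∑ b : Fin 3, kdeltaPref ι κ a 0 w * C κ a b 0 w t z) 0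
    _ ≤ ∑' u : Site d, ∑' w : Site d, ∑' t : Site d, ∑' z : Site d, ∑ κ : Fin d × Bool, ∑ a : Fin 3, ∑ b : Fin 3,
          kdeltaPref ι κ a u w * C κ a b u w t z :=
        ENNReal.le_tsum (f := fun u : Site d => ∑' w : Site d, ∑' t : Site d, ∑' z : Site d, ∑ κ : Fin d × Bool,
          ∑ a : Fin 3, ∑ b : Fin 3, kdeltaPref ι κ a u w * C κ a b u w t z) 0

/-! ### C. The assembly -/

/-- Distributing the two start pieces: `Σ (k + P) C = Σ k C + Σ P C` through four series and three finite sums.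
[folklore] -/
theorem tsum_blocks_add (k P : Fin d × Bool → Fin 3 → Site d → Site d → ℝ≥0∞)
    (C : Fin d × Bool → Fin 3 → Fin 3 → Site d → Site d → Site d → Site d → ℝ≥0∞) :
    ∑' u : Site d, ∑' w : Site d, ∑' t : Site d, ∑' z : Site d, ∑ κ : Fin d × Bool, ∑ a : Fin 3, ∑ b : Fin 3,
        (k κ a u w + P κ a u w) * C κ a b u w t z =
      (∑' u : Site d, ∑' w : Site d, ∑' t : Site d, ∑' z : Site d, ∑ κ : Fin d × Bool, ∑ a : Fin 3, ∑ b : Fin 3,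
        k κ a u w * C κ a b u w t z) +
      ∑' u : Site d, ∑' w : Site d, ∑' t : Site d, ∑' z : Site d, ∑ κ : Fin d × Bool, ∑ a : Fin 3, ∑ b : Fin 3,
        P κ a u w * C κ a b u w t z := by
  simp only [add_mul, Finset.sum_add_distrib, ENNReal.tsum_add]

/-- **[FvdH17] §6.1, the `x`-space bound on `Ξ^{(1),ι}` (lemmapercboundXiiota1-1-step0), assembly.**
Let `E(u,v,w,z,t)` (two levels, bond `(u,v)`) and `E₃(z,t)` (two levels, bond `(0,e_ι)`, `w₀ = 0`) be events with
`Ξ^{(1),ι}_p(x) ≤ Σ_{(u,v)} Σ_{w,z,t} J(v−u) ℙ_p^{⊗2}(E(u,v,w,z,t)) + Σ_{z,t} ℙ_p^{⊗2}(E₃(z,t))` (the contributions of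
`F^{ι,I}_0 ∪ F^{ι,II}_0` and of `F^{ι,III}_0`), and suppose the CLASS ESTIMATES: for every class `(a,b)`,
`J(v−u) ℙ_p^{⊗2}(E ∩ class (a,b)) ≤ Σ_κ 𝟙{v = u + e_κ} P^{ι,a}(u,w) Ā'^{κ,a,b}(u,w,t,z) P^{E,b}(t−x,z−x)`, and for
every class `b` of the last line, `ℙ_p^{⊗2}(E₃ ∩ class b) ≤ Ā'^{ι,0,b}(0,0,t,z) P^{E,b}(t−x,z−x)` ("If `F^{ι,III}_0`
occurs, then we have `w=u=0` and `κ=ι`").  Then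
`Ξ^{(1),ι}_p(x) ≤ Σ_{u,w,t,z} Σ_{κ,a,b} (δ_{a,0}δ_{ι,κ}𝟙{u=w=0} + P^{ι,a}(u,w)) Ā'^{κ,a,b}(u,w,t,z) P^{E,b}(t−x,z−x)`.
[cite: FitznerVanDerHofstad2017, §6.1 proof of Lemma 5.3, display (lemmapercboundXiiota1-1-step0) (arXiv:1506.07977v2 p. 59)] -/
theorem nobleXiIotaT_one_le_blocks_of_cls (L : Letters d) (p : unitInterval) (ι : Fin d × Bool) (x : Site d)
    (E : Site d → Site d → Site d → Site d → Site d → Set (Fin 2 → BondConfig (Site d)))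
    (E₃ : Site d → Site d → Set (Fin 2 → BondConfig (Site d)))
    (h1 : nobleXiIotaT d p (stepVec ι) 1 x ≤
      (∑' b : Site d × Site d, ∑' w : Site d, ∑' z : Site d, ∑' t : Site d,
        ENNReal.ofReal (bondJ d p (b.2 - b.1)) * piPerc d p 2 (E b.1 b.2 w z t)) +
      ∑' z : Site d, ∑' t : Site d, piPerc d p 2 (E₃ z t))
    (h2 : ∀ (a b : Fin 3) (u v w z t : Site d),
      ENNReal.ofReal (bondJ d p (v - u)) * piPerc d p 2 (E u v w z t ∩ clsSet u w t z a b) ≤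
        ∑ κ : Fin d × Bool, (if v = u + stepVec κ then (1 : ℝ≥0∞) else 0) *
          (blockPiota L ι a u w * blockAbar' L κ a b u w t z * blockPE L b (t - x) (z - x)))
    (h3 : ∀ (b : Fin 3) (z t : Site d), piPerc d p 2 (E₃ z t ∩ lineCls t z 1 b) ≤
      blockAbar' L ι 0 b 0 0 t z * blockPE L b (t - x) (z - x)) :
    nobleXiIotaT d p (stepVec ι) 1 x ≤ ∑' u, ∑' w, ∑' t, ∑' z, ∑ κ : Fin d × Bool, ∑ a : Fin 3, ∑ b : Fin 3,
      (kdeltaPref ι κ a u w + blockPiota L ι a u w) * blockAbar' L κ a b u w t z * blockPE L b (t - x) (z - x) := by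
  -- the bond-summed part, exactly as for `Ξ^{(1)}`
  have hI : (∑' b : Site d × Site d, ∑' w : Site d, ∑' z : Site d, ∑' t : Site d,
        ENNReal.ofReal (bondJ d p (b.2 - b.1)) * piPerc d p 2 (E b.1 b.2 w z t)) ≤
      ∑' u, ∑' w, ∑' t, ∑' z, ∑ κ : Fin d × Bool, ∑ a : Fin 3, ∑ b : Fin 3,
        blockPiota L ι a u w * blockAbar' L κ a b u w t z * blockPE L b (t - x) (z - x) := by
    refine le_tsum_blocks_of_pointwise _
      (fun u v w z t => ENNReal.ofReal (bondJ d p (v - u)) * piPerc d p 2 (E u v w z t))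
      (fun κ a b u w t z => blockPiota L ι a u w * blockAbar' L κ a b u w t z * blockPE L b (t - x) (z - x))
      le_rfl ?_
    intro u v w z t
    calc ENNReal.ofReal (bondJ d p (v - u)) * piPerc d p 2 (E u v w z t)
        ≤ ENNReal.ofReal (bondJ d p (v - u)) * ∑ a, ∑ b, piPerc d p 2 (E u v w z t ∩ clsSet u w t z a b) :=
          mul_le_mul' le_rfl (measure_le_sum_inter_clsSet _ _ u w t z)
      _ = ∑ a, ∑ b, ENNReal.ofReal (bondJ d p (v - u)) * piPerc d p 2 (E u v w z t ∩ clsSet u w t z a b) := by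
          rw [Finset.mul_sum]; exact Finset.sum_congr rfl fun a _ => Finset.mul_sum _ _ _
      _ ≤ ∑ a, ∑ b, ∑ κ, (if v = u + stepVec κ then (1 : ℝ≥0∞) else 0) *
            (blockPiota L ι a u w * blockAbar' L κ a b u w t z * blockPE L b (t - x) (z - x)) :=
          Finset.sum_le_sum fun a _ => Finset.sum_le_sum fun b _ => h2 a b u v w z t
  -- the bond-free part: split by the class of the last line, then it sits inside the `kdeltaPref` terms
  have hIII : (∑' z : Site d, ∑' t : Site d, piPerc d p 2 (E₃ z t)) ≤
      ∑' u, ∑' w, ∑' t, ∑' z, ∑ κ : Fin d × Bool, ∑ a : Fin 3, ∑ b : Fin 3,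
        kdeltaPref ι κ a u w * (blockAbar' L κ a b u w t z * blockPE L b (t - x) (z - x)) := by
    calc (∑' z : Site d, ∑' t : Site d, piPerc d p 2 (E₃ z t))
        ≤ ∑' z : Site d, ∑' t : Site d, ∑ b : Fin 3, blockAbar' L ι 0 b 0 0 t z * blockPE L b (t - x) (z - x) :=
          ENNReal.tsum_le_tsum fun z => ENNReal.tsum_le_tsum fun t =>
            (measure_le_sum_inter_lineCls _ _ t z 1).trans (Finset.sum_le_sum fun b _ => h3 b z t)
      _ = ∑' t : Site d, ∑' z : Site d, ∑ b : Fin 3, blockAbar' L ι 0 b 0 0 t z * blockPE L b (t - x) (z - x) :=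
          ENNReal.tsum_comm
      _ ≤ _ := le_tsum_kdeltaPref_blocks ι
          (fun κ a b u w t z => blockAbar' L κ a b u w t z * blockPE L b (t - x) (z - x))
  -- add up
  have hI' : (∑' b : Site d × Site d, ∑' w : Site d, ∑' z : Site d, ∑' t : Site d,
        ENNReal.ofReal (bondJ d p (b.2 - b.1)) * piPerc d p 2 (E b.1 b.2 w z t)) ≤
      ∑' u, ∑' w, ∑' t, ∑' z, ∑ κ : Fin d × Bool, ∑ a : Fin 3, ∑ b : Fin 3,
        blockPiota L ι a u w * (blockAbar' L κ a b u w t z * blockPE L b (t - x) (z - x)) := by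
    simpa only [mul_assoc] using hI
  calc nobleXiIotaT d p (stepVec ι) 1 x ≤ _ := h1
    _ ≤ (∑' u, ∑' w, ∑' t, ∑' z, ∑ κ : Fin d × Bool, ∑ a : Fin 3, ∑ b : Fin 3,
            kdeltaPref ι κ a u w * (blockAbar' L κ a b u w t z * blockPE L b (t - x) (z - x))) +
          ∑' u, ∑' w, ∑' t, ∑' z, ∑ κ : Fin d × Bool, ∑ a : Fin 3, ∑ b : Fin 3,
            blockPiota L ι a u w * (blockAbar' L κ a b u w t z * blockPE L b (t - x) (z - x)) := by
        rw [add_comm]; exact add_le_add hIII hI'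
    _ = ∑' u, ∑' w, ∑' t, ∑' z, ∑ κ : Fin d × Bool, ∑ a : Fin 3, ∑ b : Fin 3,
          (kdeltaPref ι κ a u w + blockPiota L ι a u w) * (blockAbar' L κ a b u w t z * blockPE L b (t - x) (z - x)) :=
        (tsum_blocks_add (fun κ a u w => kdeltaPref ι κ a u w) (fun _ a u w => blockPiota L ι a u w)
          (fun κ a b u w t z => blockAbar' L κ a b u w t z * blockPE L b (t - x) (z - x))).symm
    _ = _ := by simp only [mul_assoc]

end Literature.Probability.FitznerVanDerHofstad2017

end
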